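import Literature.AlgebraicGeometry.Motives.TannakianDeligneTorusExtendedMumfordTateScheme
import Literature.AlgebraicGeometry.Motives.TannakianDeligneTorusMumfordTateBasisChange
import HarnessLib

/-!
# MOONEN's extended Mumford–Tate group `M̃T(H) ⊂ GL(V) × 𝔾_m` DOES NOT DEPEND ON THE BASIS: under `b ↦ b′` its ideal in
# `O(GL_ι) ⊗ ℚ[T,T⁻¹]` is transported by the automorphism `inn(P)^* ⊗ id` (`P = [id]_{b′ → b}`), and its `T`-points are
# conjugate by `(P, 1)` (Milne 1.84, 2.8, 2.30, 2.46, 3.11; Moonen 1999 (1.14); Green–Griffiths–Kerr §I.B; Deligne I 3.4)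

[topic AlgebraicGeometry/Motives]

Layer `Literature/AlgebraicGeometry/Motives`, lane `lit-hodgefound` (Track 2 foundations library — Layer A3 «Mumford–Tate
group»; prover seat `lit-hodgefound-p26`, gen 53, row g53-#8). Sequel of g51-#7 `Motives/TannakianDeligneTorusExtendedMumfordTateScheme`
(`extHodgeHomRat H b = (h × Nm)^*`, `extMumfordTateIdeal H b ⊂ O(GL_ι) ⊗ ℚ[T,T⁻¹]`, `extMumfordTatePoints H b T` — all defined
through a CHOSEN `ℚ`-basis `b` of `V`), g49-#3 `…MumfordTateBasisChange` (`hodgeHomRat_basisChange : h_{b′}^* = h_b^* ∘ inn(P)^*`,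
`mumfordTateIdeal_basisChange`, `GLn.comap_innerAut_eq_map`), g49-#2 `…GeneralLinearGroupInnerAutomorphisms` (`GLn.innerAut P`,
`innerAutBialgHom`, `innerAut_mul ∕ _one`, `GLn.basisChange b b′ = [id]_{b′ → b}`, `pointMatrix_comp_innerAut`) and g50-#1
`Motives/TannakianGeneratedSubgroupImage` (**`genIdeal_comp_bialgHom`**). THEOREMS only; no definition, no named fact, no
instance, no notation.

## The sources, verbatim

B. Moonen, *Notes on Mumford–Tate groups* (1999) [Moonen1999MTNotes], (1.14) (as quoted by g51-#7): "`M̃T(V)` can be described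
as the smallest algebraic `ℚ`-subgroup `M ⊂ GL(V) × 𝔾_{m,ℚ}` such that `h × Nm : 𝕊 → GL(V)_ℝ × 𝔾_{m,ℝ}` factors through `M_ℝ`"
— a subgroup of `GL(V) × 𝔾_m`, no basis in sight. J. S. Milne, *Algebraic Groups* [Milne2017], 2.8: "the choice of a basis for
`V` determines an isomorphism `GL_V → GL_n`"; Ch. 1 after Prop. 1.84: "the inner automorphism `x ↦ gxg⁻¹` … of `G`"; 2.30:
"`O(G₁ × G₂) ≃ O(G₁) ⊗ O(G₂)`"; Ch. 3 §b Prop. 3.11; M. Green, P. Griffiths, M. Kerr [GreenGriffithsKerr2012], §I.B (I.B.4):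
"`f(Ȳ^ℚ) = \overline{f(Y)}^ℚ`"; P. Deligne, LNM 900 (1982), I Prop. 3.4 [Deligne1982HodgeCycles]; J. Carlson, S. Müller-Stach,
C. Peters [CarlsonMullerStachPeters2017], §15.2 Def. 15.2.1, Remark 15.2.13.

READING (recorded — RULING 29; no named fact). The tree DEFINES `M̃T(H)` through a chosen basis `b` (g51-#7); the sources define
it inside `GL(V) × 𝔾_m`. §1 (`GLn`, general `R`) The automorphism `inn(P)^* ⊗ id` of `O(GL_ι × 𝔾_m) = O(GL_ι) ⊗ R[T,T⁻¹]` —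
the comorphism of the inner automorphism of `(P, 1) ∈ (GL_ι × 𝔾_m)(R)` — composes like `inn` (**`map_innerAut_comp_map_innerAut`**),
has inverse `inn(P⁻¹)^* ⊗ id`, transports ideals by **`comap_map_innerAut_eq_map : (inn(P)^* ⊗ id)⁻¹(I) = (inn(P⁻¹)^* ⊗ id)(I)`**
and acts on `B`-points by **`productMap_comp_map_innerAut : (x, y) ∘ (inn(P)^* ⊗ id) = (x ∘ inn(P)^*, y)`** (matrix `(P_B [x]
P_B⁻¹, y)`). §2 For a Hodge structure `H` and two `ℚ`-bases `b, b′` of `V`, `P = [id]_{b′ → b} = GLn.basisChange b b′`: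
**`extHodgeHomRat_basisChange : (h × Nm)_{b′}^* = (h × Nm)_b^* ∘ (inn(P)^* ⊗ id)`** (g49-#3 on the first factor), hence by GGK
(I.B.4) along the bialgebra automorphism `innerAutBialgHom P ⊗ id` **`extMumfordTateIdeal_basisChange : I_{M̃T}(b′) = (inn(P)^* ⊗
id)⁻¹ I_{M̃T}(b)`** = **`(inn(P⁻¹)^* ⊗ id) I_{M̃T}(b)`** (`_eq_map`) — the two ideals cut out THE SAME subgroup scheme of `GL(V) ×
𝔾_m` — and on `T`-points **`productMap_mem_extMumfordTatePoints_basisChange_iff : (x, y) ∈ M̃T_{b′}(T) ⟺ (x ∘ inn(P⁻¹)^*, y) ∈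
M̃T_b(T)`**, the conjugating matrix being `[id]_{b → b′} [x] [id]_{b′ → b}` (g49-#3 `pointMatrix_comp_innerAut_basisChange`): the
extended Mumford–Tate groups computed in two bases are conjugate by `(P, 1)`, one and the same subgroup of `GL(V_T) × T^×`.

## Contents (namespaces `…Tannakian.GLn`, `…Tannakian.DeligneTorus`)

* §1 `GLn`: `map_innerAut_comp_map_innerAut`, `map_innerAut_one`, `map_innerAut_map_innerAut_inv`, `map_innerAut_inv_map_innerAut`,
  **`comap_map_innerAut_eq_map`**, `comap_map_innerAut_le_ker_iff`, **`productMap_comp_map_innerAut`**.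
* §2 `DeligneTorus`: **`extHodgeHomRat_basisChange`**, `extHodgeHomRat_basisChange_apply`, `ker_extHodgeHomRat_basisChange`,
  **`extMumfordTateIdeal_basisChange`**, **`extMumfordTateIdeal_basisChange_eq_map`**, **`productMap_mem_extMumfordTatePoints_basisChange_iff`**,
  `mem_extMumfordTatePoints_basisChange_iff`.
-/

namespace Literature.AlgebraicGeometry.Motives.Tannakian

open TensorProduct WithConv

universe u v w

namespace GLn

/-! ## §1 The automorphism `inn(P)^* ⊗ id` of `O(GL_ι) ⊗ R[T,T⁻¹]` -/

section InnerExt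

variable {R : Type u} [CommRing R] {ι : Type v} [Fintype ι] [DecidableEq ι]

/-- **`(inn(P)^* ⊗ id) ∘ (inn(Q)^* ⊗ id) = inn(QP)^* ⊗ id`** (`inn(PQ)^* = inn(Q)^* ∘ inn(P)^*`, g49-#2 `innerAut_mul`). [cite:
Milne2017, Ch. 1 after Prop. 1.84, 2.30] -/
theorem map_innerAut_comp_map_innerAut (P Q : Matrix.GeneralLinearGroup ι R) :
    (Algebra.TensorProduct.map (innerAut P) (AlgHom.id R (LaurentPolynomial R))).comp
        (Algebra.TensorProduct.map (innerAut Q) (AlgHom.id R (LaurentPolynomial R))) =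
      Algebra.TensorProduct.map (innerAut (Q * P)) (AlgHom.id R (LaurentPolynomial R)) := by
  rw [← Algebra.TensorProduct.map_comp, ← innerAut_mul, AlgHom.comp_id]

/-- `inn(1)^* ⊗ id = id`. [cite: Milne2017, Ch. 1 after Prop. 1.84, 2.30] -/
theorem map_innerAut_one :
    Algebra.TensorProduct.map (innerAut (1 : Matrix.GeneralLinearGroup ι R)) (AlgHom.id R (LaurentPolynomial R)) =
      AlgHom.id R (Coord R ι ⊗[R] LaurentPolynomial R) := by
  rw [innerAut_one, Algebra.TensorProduct.map_id]

/-- `(inn(P)^* ⊗ id)((inn(P⁻¹)^* ⊗ id) e) = e`. [cite: Milne2017, Ch. 1 after Prop. 1.84, 2.30] -/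
theorem map_innerAut_map_innerAut_inv (P : Matrix.GeneralLinearGroup ι R) (e : Coord R ι ⊗[R] LaurentPolynomial R) :
    Algebra.TensorProduct.map (innerAut P) (AlgHom.id R (LaurentPolynomial R))
        (Algebra.TensorProduct.map (innerAut P⁻¹) (AlgHom.id R (LaurentPolynomial R)) e) = e := by
  rw [← AlgHom.comp_apply, map_innerAut_comp_map_innerAut, inv_mul_cancel, map_innerAut_one, AlgHom.id_apply]

/-- `(inn(P⁻¹)^* ⊗ id)((inn(P)^* ⊗ id) e) = e`. [cite: Milne2017, Ch. 1 after Prop. 1.84, 2.30] -/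
theorem map_innerAut_inv_map_innerAut (P : Matrix.GeneralLinearGroup ι R) (e : Coord R ι ⊗[R] LaurentPolynomial R) :
    Algebra.TensorProduct.map (innerAut P⁻¹) (AlgHom.id R (LaurentPolynomial R))
        (Algebra.TensorProduct.map (innerAut P) (AlgHom.id R (LaurentPolynomial R)) e) = e := by
  rw [← AlgHom.comp_apply, map_innerAut_comp_map_innerAut, mul_inv_cancel, map_innerAut_one, AlgHom.id_apply]

/-- **`(inn(P)^* ⊗ id)⁻¹(I) = (inn(P⁻¹)^* ⊗ id)(I)`** for every ideal of `O(GL_ι) ⊗ R[T,T⁻¹]`: preimage under the automorphism is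
image under its inverse. [cite: Milne2017, Ch. 1 after Prop. 1.84, 2.30; GreenGriffithsKerr2012, §I.B (I.B.4)] -/
theorem comap_map_innerAut_eq_map (P : Matrix.GeneralLinearGroup ι R) (I : Ideal (Coord R ι ⊗[R] LaurentPolynomial R)) :
    I.comap (Algebra.TensorProduct.map (innerAut P) (AlgHom.id R (LaurentPolynomial R))) =
      I.map (Algebra.TensorProduct.map (innerAut P⁻¹) (AlgHom.id R (LaurentPolynomial R))) := by
  refine le_antisymm (fun e he => ?_) (Ideal.map_le_iff_le_comap.2 fun e he => ?_)
  · have h := Ideal.mem_map_of_mem (Algebra.TensorProduct.map (innerAut P⁻¹) (AlgHom.id R (LaurentPolynomial R)))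
      (Ideal.mem_comap.1 he)
    rwa [map_innerAut_inv_map_innerAut] at h
  · rw [Ideal.mem_comap, Ideal.mem_comap, map_innerAut_map_innerAut_inv]
    exact he

variable {B : Type w} [CommRing B] [Algebra R B]

/-- A point `g` of `GL_ι × 𝔾_m` kills `(inn(P)^* ⊗ id)⁻¹(I)` iff `g ∘ (inn(P⁻¹)^* ⊗ id)` kills `I`. [cite: Milne2017, Ch. 1 after
Prop. 1.84, 1.e] -/
theorem comap_map_innerAut_le_ker_iff (P : Matrix.GeneralLinearGroup ι R) (I : Ideal (Coord R ι ⊗[R] LaurentPolynomial R))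
    (g : Coord R ι ⊗[R] LaurentPolynomial R →ₐ[R] B) :
    I.comap (Algebra.TensorProduct.map (innerAut P) (AlgHom.id R (LaurentPolynomial R))) ≤ RingHom.ker g ↔
      I ≤ RingHom.ker (g.comp (Algebra.TensorProduct.map (innerAut P⁻¹) (AlgHom.id R (LaurentPolynomial R)))) := by
  rw [comap_map_innerAut_eq_map, Ideal.map_le_iff_le_comap, AlgHom.comap_ker]

/-- **On `B`-points: `(x, y) ∘ (inn(P)^* ⊗ id) = (x ∘ inn(P)^*, y)`** — conjugation of the first component by `P` (matrix `P_B
[x] P_B⁻¹`, g49-#2 `pointMatrix_comp_innerAut`), the multiplier unchanged. [cite: Milne2017, Ch. 1 after Prop. 1.84 («x ↦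
gxg⁻¹»), 2.30, 2.8] -/
theorem productMap_comp_map_innerAut (P : Matrix.GeneralLinearGroup ι R) (x : Coord R ι →ₐ[R] B) (y : LaurentPolynomial R →ₐ[R] B) :
    (Algebra.TensorProduct.productMap x y).comp (Algebra.TensorProduct.map (innerAut P) (AlgHom.id R (LaurentPolynomial R))) =
      Algebra.TensorProduct.productMap (x.comp (innerAut P)) y := by
  refine Algebra.TensorProduct.ext' fun a z => ?_
  rw [AlgHom.comp_apply, Algebra.TensorProduct.map_tmul, Algebra.TensorProduct.productMap_apply_tmul,
    Algebra.TensorProduct.productMap_apply_tmul, AlgHom.id_apply, AlgHom.comp_apply]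

end InnerExt

end GLn

namespace DeligneTorus

open HodgeStructure

variable {V : Type u} [AddCommGroup V] [Module ℚ V] {n : ℤ} {ι : Type v} [Fintype ι] [DecidableEq ι]

/-! ## §2 `M̃T(H)` in two bases: transported by `inn(P)^* ⊗ id`, conjugate by `(P, 1)` on points -/

/-- **`(h × Nm)_{b′}^* = (h × Nm)_b^* ∘ (inn(P)^* ⊗ id)`, `P = [id]_{b′ → b}`**: MOONEN's generating point of `M̃T` read in the
basis `b′` is the one in the basis `b` preceded by the inner automorphism of `(P, 1) ∈ (GL_ι × 𝔾_m)(ℚ)` (g49-#3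
`hodgeHomRat_basisChange` on the first factor; `Nm^*` untouched). [cite: Moonen1999MTNotes, (1.14); Milne2017, 2.8, Ch. 1 after
Prop. 1.84, 2.30; GreenGriffithsKerr2012, §I.B (i)] -/
theorem extHodgeHomRat_basisChange (H : HodgeStructure V n) (b b' : Module.Basis ι ℚ V) :
    extHodgeHomRat H b' =
      (extHodgeHomRat H b).comp
        (Algebra.TensorProduct.map (GLn.innerAut (GLn.basisChange b b')) (AlgHom.id ℚ (LaurentPolynomial ℚ))) := by
  refine Algebra.TensorProduct.ext' fun a x => ?_
  rw [AlgHom.comp_apply, Algebra.TensorProduct.map_tmul, extHodgeHomRat_tmul, extHodgeHomRat_tmul, AlgHom.id_apply,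
    hodgeHomRat_basisChange_apply H b b']

/-- Pointwise: `(h × Nm)_{b′}^*(e) = (h × Nm)_b^*((inn(P)^* ⊗ id) e)`. [cite: Moonen1999MTNotes, (1.14); Milne2017, 2.8] -/
theorem extHodgeHomRat_basisChange_apply (H : HodgeStructure V n) (b b' : Module.Basis ι ℚ V)
    (e : GLn.Coord ℚ ι ⊗[ℚ] LaurentPolynomial ℚ) :
    extHodgeHomRat H b' e =
      extHodgeHomRat H b (Algebra.TensorProduct.map (GLn.innerAut (GLn.basisChange b b')) (AlgHom.id ℚ (LaurentPolynomial ℚ)) e) := by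
  rw [extHodgeHomRat_basisChange H b b', AlgHom.comp_apply]

/-- `ker (h × Nm)_{b′}^* = (inn(P)^* ⊗ id)⁻¹ (ker (h × Nm)_b^*)`. [cite: Moonen1999MTNotes, (1.14); Milne2017, 2.h Prop. 2.46] -/
theorem ker_extHodgeHomRat_basisChange (H : HodgeStructure V n) (b b' : Module.Basis ι ℚ V) :
    RingHom.ker (extHodgeHomRat H b') =
      (RingHom.ker (extHodgeHomRat H b)).comap
        (Algebra.TensorProduct.map (GLn.innerAut (GLn.basisChange b b')) (AlgHom.id ℚ (LaurentPolynomial ℚ))) := by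
  rw [extHodgeHomRat_basisChange H b b']
  exact Ideal.ext fun _ => Iff.rfl

/-- **`M̃T(H)` DOES NOT DEPEND ON THE BASIS: `I_{M̃T}(b′) = (inn(P)^* ⊗ id)⁻¹ (I_{M̃T}(b))`, `P = [id]_{b′ → b}`** — the ideals of
MOONEN's `M̃T(H) ⊂ GL_ι × 𝔾_m` computed in two `ℚ`-bases correspond under the bialgebra automorphism `inn(P)^* ⊗ id` of `O(GL_ι) ⊗
ℚ[T,T⁻¹]` (GGK (I.B.4) for the isomorphism `inn(P) × id`, g50-#1 `genIdeal_comp_bialgHom`); they cut out the same subgroup scheme of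
`GL(V) × 𝔾_m`. [cite: Moonen1999MTNotes, (1.14) («M ⊂ GL(V) × 𝔾_{m,ℚ}»); Milne2017, 2.8 («the choice of a basis for V determines
an isomorphism GL_V → GL_n»), 2.30, 2.h Prop. 2.46, Ch. 3 §b Prop. 3.11; GreenGriffithsKerr2012, §I.B (I.B.4); Deligne1982HodgeCycles,
I Prop. 3.4; CarlsonMullerStachPeters2017, Remark 15.2.13] -/
theorem extMumfordTateIdeal_basisChange (H : HodgeStructure V n) (b b' : Module.Basis ι ℚ V) :
    extMumfordTateIdeal H b' =
      (extMumfordTateIdeal H b).comap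
        (Algebra.TensorProduct.map (GLn.innerAut (GLn.basisChange b b')) (AlgHom.id ℚ (LaurentPolynomial ℚ))) := by
  letI := GLn.hopfAlgebra ℚ ι
  have hc : (extMumfordTateIdeal H b).comap
        (Algebra.TensorProduct.map (GLn.innerAut (GLn.basisChange b b')) (AlgHom.id ℚ (LaurentPolynomial ℚ))) =
      (extMumfordTateIdeal H b).comap (Bialgebra.TensorProduct.map (GLn.innerAutBialgHom (GLn.basisChange b b'))
        (BialgHom.id ℚ (LaurentPolynomial ℚ))) := Ideal.ext fun _ => Iff.rfl
  rw [hc, extMumfordTateIdeal_eq_genIdeal, extMumfordTateIdeal_eq_genIdeal, ← genIdeal_comp_bialgHom]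
  exact congrArg (genIdeal ℚ) (funext fun _ => extHodgeHomRat_basisChange H b b')

/-- The same as an image: **`I_{M̃T}(b′) = (inn(P⁻¹)^* ⊗ id)(I_{M̃T}(b))`**, `P⁻¹ = [id]_{b → b′} = basisChange b′ b`. [cite:
Moonen1999MTNotes, (1.14); Milne2017, 2.8, Ch. 1 after Prop. 1.84] -/
theorem extMumfordTateIdeal_basisChange_eq_map (H : HodgeStructure V n) (b b' : Module.Basis ι ℚ V) :
    extMumfordTateIdeal H b' =
      (extMumfordTateIdeal H b).map
        (Algebra.TensorProduct.map (GLn.innerAut (GLn.basisChange b' b)) (AlgHom.id ℚ (LaurentPolynomial ℚ))) := by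
  rw [extMumfordTateIdeal_basisChange H b b', GLn.comap_map_innerAut_eq_map, GLn.basisChange_inv]

variable {T : Type w} [CommRing T] [Algebra ℚ T]

/-- **On `T`-points: `(x, y) ∈ M̃T_{b′}(H)(T) ⟺ (x ∘ inn(P⁻¹)^*, y) ∈ M̃T_b(H)(T)`** (`P = [id]_{b′ → b}`; the conjugated point has
matrix `[id]_{b → b′} · [x] · [id]_{b′ → b}`, g49-#3 `pointMatrix_comp_innerAut_basisChange`): the extended Mumford–Tate groups
computed in two bases are CONJUGATE by `(P, 1)` in `GL_ι(T) × T^×` — one and the same subgroup of `GL(V_T) × T^×`. [cite: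
Moonen1999MTNotes, (1.14); Milne2017, 2.8, Ch. 1 after Prop. 1.84, 2.30; Deligne1982HodgeCycles, I §3 («(g₁, g₂) ∈ G ⊆ GL(V) ×
𝔾_m»); GreenGriffithsKerr2012, §I.B (i)] -/
theorem productMap_mem_extMumfordTatePoints_basisChange_iff (H : HodgeStructure V n) (b b' : Module.Basis ι ℚ V)
    (x : GLn.Coord ℚ ι →ₐ[ℚ] T) (y : LaurentPolynomial ℚ →ₐ[ℚ] T) :
    letI := GLn.bialgebra ℚ ι
    toConv (Algebra.TensorProduct.productMap x y) ∈ extMumfordTatePoints H b' T ↔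
      toConv (Algebra.TensorProduct.productMap (x.comp (GLn.innerAut (GLn.basisChange b' b))) y) ∈
        extMumfordTatePoints H b T := by
  letI := GLn.bialgebra ℚ ι
  rw [productMap_mem_extMumfordTatePoints_iff, productMap_mem_extMumfordTatePoints_iff, extMumfordTateIdeal_basisChange H b b',
    GLn.comap_map_innerAut_le_ker_iff, GLn.basisChange_inv, GLn.productMap_comp_map_innerAut]

/-- **On `T`-points, for an arbitrary point `g` of `GL_ι × 𝔾_m`: `g ∈ M̃T_{b′}(H)(T) ⟺ g ∘ (inn(P⁻¹)^* ⊗ id) ∈ M̃T_b(H)(T)`.**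
[cite: Moonen1999MTNotes, (1.14); Milne2017, 2.8, Ch. 1 after Prop. 1.84, 2.30] -/
theorem mem_extMumfordTatePoints_basisChange_iff (H : HodgeStructure V n) (b b' : Module.Basis ι ℚ V)
    (g : WithConv (GLn.Coord ℚ ι ⊗[ℚ] LaurentPolynomial ℚ →ₐ[ℚ] T)) :
    letI := GLn.bialgebra ℚ ι
    g ∈ extMumfordTatePoints H b' T ↔
      toConv (g.ofConv.comp
        (Algebra.TensorProduct.map (GLn.innerAut (GLn.basisChange b' b)) (AlgHom.id ℚ (LaurentPolynomial ℚ)))) ∈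
          extMumfordTatePoints H b T := by
  letI := GLn.bialgebra ℚ ι
  rw [mem_extMumfordTatePoints_iff, mem_extMumfordTatePoints_iff, extMumfordTateIdeal_basisChange H b b',
    GLn.comap_map_innerAut_le_ker_iff, GLn.basisChange_inv, WithConv.ofConv_toConv]

end DeligneTorus

end Literature.AlgebraicGeometry.Motives.Tannakian
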